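import Mathlib
import Literature.Computability.AlgebraicComplexity.MignonRessayreBound

/-!
# Second-order flat subspaces of the permanent have dimension `≤ 2n`

Crux `GrenetZeon.TwoDimCoefficients` (stmt-ValiantsHypothesis-8062), line `dim2_cases`, stub
`stub_dualUnipotent` (`DualUnipotentBound`) — the PERMANENT half of the flatness rung
(`GrenetZeonTwoDimCoefficientsDualUnipotentFlat.lean`).

**Theorem (`finrank_le_of_hess0_perPoly_isOrtho`).** Let `K` be a linear subspace of `n × n`
matrices that is totally isotropic for the Hessian of `per_n` at EVERY point `p`
(`uᵀ · Hess per_n(p) · v = 0` for `u, v ∈ K`; equivalently, `per_n` is affine along every coset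
`x + K`).  Then `dim K ≤ 2n`.  (A row or a column gives `dim K = n`, so the order is sharp.)

Proof.  The Hessian of `per_n` at the permutation matrix of `τ` with two columns `j₀ ≠ b'` zeroed
is the polarised `2 × 2` permanent on rows `{τ j₀, τ b'}` and columns `{j₀, b'}`
(`toBilin_hess0_perPoly_testPoint`, from the tree's `hess0_transl_perPoly`: only the two
permutations `τ`, `τ ∘ (j₀ b')` and the two column pairs survive).  If `w ∈ K` has
`w_{i₀ j₀} ≠ 0`, testing against `w` shows that an element of `K` with zero row `i₀` and zero
column `j₀` vanishes, so `v ↦ (row i₀, column j₀)` is injective on `K`.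

Used by the flatness rung: in a dual representation `per_n = α·det A + β·tr(adj A · B)` the
permanent is affine along `ker(linear part of A)`, which therefore has dimension `≤ 2n`.

HONEST FRAMING: an elementary lemma about the permanent serving a constant-factor rung of an
ASIDE item; `VP ≠ VNP` is not moved by anything here.

References: T. Mignon, N. Ressayre, Int. Math. Res. Not. 2004:79, §3 (second partials of the
permanent are sub-permanents); J. M. Landsberg, *Geometry and Complexity Theory* (2017), §6.4.6.
-/

set_option linter.dupNamespace false

noncomputable section

namespace Summit.ValiantsHypothesis.ValiantsHypothesis.Cruxes.TwoDimCoefficients.DimTwoCases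

open MvPolynomial Matrix
open Literature.Computability.AlgebraicComplexity

/-! ### Second-order flat subspaces of the permanent have dimension `≤ 2n` -/

section PermanentFlat

variable {n : ℕ}

/-- A permutation agreeing with `τ` off two points `j₀ ≠ b'` is `τ` or `τ ∘ (j₀ b')`. [folklore] -/
theorem perm_eq_or_eq_mul_swap_of_agree (π τ : Equiv.Perm (Fin n)) {j₀ b' : Fin n} (hjb : j₀ ≠ b')
    (h : ∀ i, i ≠ j₀ → i ≠ b' → π i = τ i) : π = τ ∨ π = τ * Equiv.swap j₀ b' := by
  set ρ := τ⁻¹ * π with hρdef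
  have hρ : ∀ i, i ≠ j₀ → i ≠ b' → ρ i = i := fun i h1 h2 => by
    rw [hρdef, Equiv.Perm.mul_apply, h i h1 h2]
    simp
  -- `ρ` maps `{j₀, b'}` into itself
  have hinto : ∀ i, i = j₀ ∨ i = b' → ρ i = j₀ ∨ ρ i = b' := by
    intro i hi
    by_contra hne
    push Not at hne
    have hfix := hρ (ρ i) hne.1 hne.2
    have hii : ρ i = i := ρ.injective hfix
    rw [hii] at hne
    rcases hi with rfl | rfl
    · exact hne.1 rfl
    · exact hne.2 rfl
  rcases hinto j₀ (Or.inl rfl) with hj | hj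
  · -- `ρ j₀ = j₀`, hence `ρ b' = b'` and `ρ = 1`
    left
    have hb : ρ b' = b' := by
      rcases hinto b' (Or.inr rfl) with hb | hb
      · exact absurd (ρ.injective (hb.trans hj.symm)) hjb.symm
      · exact hb
    have hρ1 : ρ = 1 := by
      ext i
      by_cases h1 : i = j₀
      · subst h1; simp [hj]
      by_cases h2 : i = b'
      · subst h2; simp [hb]
      simp [hρ i h1 h2]
    have := hρ1
    rw [hρdef, inv_mul_eq_one] at this
    exact this.symm
  · -- `ρ j₀ = b'`, hence `ρ b' = j₀` and `ρ = swap j₀ b'`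
    right
    have hb : ρ b' = j₀ := by
      rcases hinto b' (Or.inr rfl) with hb | hb
      · exact hb
      · exact absurd (ρ.injective (hb.trans hj.symm)) hjb.symm
    have hρ1 : ρ = Equiv.swap j₀ b' := by
      ext i
      by_cases h1 : i = j₀
      · subst h1; simp [hj, Equiv.swap_apply_left]
      by_cases h2 : i = b'
      · subst h2; simp [hb, Equiv.swap_apply_right]
      rw [hρ i h1 h2, Equiv.swap_apply_of_ne_of_ne h1 h2]
    have := hρ1
    rw [hρdef, inv_mul_eq_iff_eq_mul] at this
    exact this

/-- The inner sum at a fixed permutation `π`: only `π ∈ {τ, τ ∘ (j₀ b')}` and the two column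
pairs `{j₀, b'}` contribute. [folklore] -/
theorem sum_testPoint_perm (τ π : Equiv.Perm (Fin n)) {j₀ b' : Fin n} (hjb : j₀ ≠ b')
    (u v : Fin n × Fin n → ℂ) :
    (∑ db : Fin n × Fin n, if db.1 ≠ db.2 then
        u (π db.1, db.1) *
          (∏ i ∈ (Finset.univ.erase db.2).erase db.1,
            (if i ≠ j₀ ∧ i ≠ b' ∧ π i = τ i then (1 : ℂ) else 0)) * v (π db.2, db.2) else 0) =
      if (∀ i, i ≠ j₀ → i ≠ b' → π i = τ i) then
        u (π b', b') * v (π j₀, j₀) + u (π j₀, j₀) * v (π b', b') else 0 := by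
  classical
  -- the product is `1` iff `{d, b} = {j₀, b'}` and `π` agrees with `τ` off `{j₀, b'}`
  have hmem : ∀ d b i : Fin n, i ∈ (Finset.univ.erase b).erase d ↔ i ≠ d ∧ i ≠ b := by
    intro d b i
    simp [Finset.mem_erase]
  have hprod : ∀ d b : Fin n, d ≠ b →
      ((∀ i ∈ (Finset.univ.erase b).erase d, (i ≠ j₀ ∧ i ≠ b' ∧ π i = τ i)) ↔
        (((d = b' ∧ b = j₀) ∨ (d = j₀ ∧ b = b')) ∧ ∀ i, i ≠ j₀ → i ≠ b' → π i = τ i)) := by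
    intro d b hdb
    constructor
    · intro hall
      have hj : j₀ = d ∨ j₀ = b := by
        by_contra hne
        push Not at hne
        exact (hall j₀ ((hmem d b j₀).mpr hne)).1 rfl
      have hb' : b' = d ∨ b' = b := by
        by_contra hne
        push Not at hne
        exact (hall b' ((hmem d b b').mpr hne)).2.1 rfl
      have hdb' : (d = b' ∧ b = j₀) ∨ (d = j₀ ∧ b = b') := by
        rcases hj with hj | hj <;> rcases hb' with hb' | hb'
        · exact absurd (hj.trans hb'.symm) hjb
        · exact Or.inr ⟨hj.symm, hb'.symm⟩
        · exact Or.inl ⟨hb'.symm, hj.symm⟩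
        · exact absurd (hj.trans hb'.symm) hjb
      refine ⟨hdb', fun i h1 h2 => ?_⟩
      have hi : i ∈ (Finset.univ.erase b).erase d := by
        rw [hmem]
        rcases hdb' with ⟨rfl, rfl⟩ | ⟨rfl, rfl⟩
        · exact ⟨h2, h1⟩
        · exact ⟨h1, h2⟩
      exact (hall i hi).2.2
    · rintro ⟨hdb', hgood⟩ i hi
      rw [hmem] at hi
      have h12 : i ≠ j₀ ∧ i ≠ b' := by
        rcases hdb' with ⟨rfl, rfl⟩ | ⟨rfl, rfl⟩
        · exact ⟨hi.2, hi.1⟩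
        · exact ⟨hi.1, hi.2⟩
      exact ⟨h12.1, h12.2, hgood i h12.1 h12.2⟩
  simp_rw [Finset.prod_boole]
  by_cases hgood : ∀ i, i ≠ j₀ → i ≠ b' → π i = τ i
  · rw [if_pos hgood]
    have hpair : ((b', j₀) : Fin n × Fin n) ≠ (j₀, b') := fun h => hjb (Prod.ext_iff.mp h).1.symm
    rw [← Finset.sum_subset (Finset.subset_univ ({(b', j₀), (j₀, b')} : Finset (Fin n × Fin n))),
      Finset.sum_pair hpair]
    · simp only [ne_eq]
      rw [if_pos hjb.symm, if_pos hjb, if_pos ((hprod b' j₀ hjb.symm).mpr ⟨Or.inl ⟨rfl, rfl⟩, hgood⟩),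
        if_pos ((hprod j₀ b' hjb).mpr ⟨Or.inr ⟨rfl, rfl⟩, hgood⟩)]
      ring
    · intro db _ hdb
      obtain ⟨d, b⟩ := db
      dsimp only
      by_cases hne : d ≠ b
      · rw [if_pos hne]
        have : ¬ (∀ i ∈ (Finset.univ.erase b).erase d, (i ≠ j₀ ∧ i ≠ b' ∧ π i = τ i)) := by
          rw [hprod d b hne]
          rintro ⟨hdb', -⟩
          apply hdb
          rcases hdb' with ⟨rfl, rfl⟩ | ⟨rfl, rfl⟩ <;> simp
        rw [if_neg this, mul_zero, zero_mul]
      · rw [if_neg hne]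
  · rw [if_neg hgood]
    refine Finset.sum_eq_zero fun db _ => ?_
    obtain ⟨d, b⟩ := db
    dsimp only
    by_cases hne : d ≠ b
    · rw [if_pos hne]
      have : ¬ (∀ i ∈ (Finset.univ.erase b).erase d, (i ≠ j₀ ∧ i ≠ b' ∧ π i = τ i)) := by
        rw [hprod d b hne]
        exact fun h => hgood h.2
      rw [if_neg this, mul_zero, zero_mul]
    · rw [if_neg hne]

/-- **The Hessian of the permanent at the test point is a polarised `2 × 2` permanent.** At the
permutation matrix of `τ` with the columns `j₀ ≠ b'` zeroed, the bilinear form of the Hessian of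
`per_n` is `(u, v) ↦ u_{τb',b'} v_{τj₀,j₀} + u_{τj₀,j₀} v_{τb',b'} + u_{τj₀,b'} v_{τb',j₀} +
u_{τb',j₀} v_{τj₀,b'}`. [folklore] -/
theorem toBilin_hess0_perPoly_testPoint (τ : Equiv.Perm (Fin n)) {j₀ b' : Fin n} (hjb : j₀ ≠ b')
    (u v : Fin n × Fin n → ℂ) :
    Matrix.toBilin' (hess0 (transl (fun rc : Fin n × Fin n =>
        if rc.2 ≠ j₀ ∧ rc.2 ≠ b' ∧ rc.1 = τ rc.2 then (1 : ℂ) else 0) (perPoly (Fin n) ℂ))) u v =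
      u (τ b', b') * v (τ j₀, j₀) + u (τ j₀, j₀) * v (τ b', b') +
        (u (τ j₀, b') * v (τ b', j₀) + u (τ b', j₀) * v (τ j₀, b')) := by
  classical
  set P : Fin n × Fin n → ℂ :=
    fun rc => if rc.2 ≠ j₀ ∧ rc.2 ≠ b' ∧ rc.1 = τ rc.2 then 1 else 0 with hP
  -- entries of the Hessian at `P`
  have hM : ∀ s t : Fin n × Fin n, hess0 (transl P (perPoly (Fin n) ℂ)) s t =
      ∑ π : Equiv.Perm (Fin n), if π t.2 = t.1 ∧ s.2 ≠ t.2 ∧ π s.2 = s.1 then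
        ∏ i ∈ (Finset.univ.erase t.2).erase s.2, P (π i, i) else 0 := by
    rintro ⟨c, d⟩ ⟨a, b⟩
    exact hess0_transl_perPoly P a b c d
  -- Step A: the bilinear form as a sum over permutations
  have hA : Matrix.toBilin' (hess0 (transl P (perPoly (Fin n) ℂ))) u v =
      ∑ π : Equiv.Perm (Fin n), ∑ s : Fin n × Fin n, ∑ t : Fin n × Fin n,
        u s * (if π t.2 = t.1 ∧ s.2 ≠ t.2 ∧ π s.2 = s.1 then
          ∏ i ∈ (Finset.univ.erase t.2).erase s.2, P (π i, i) else 0) * v t := by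
    rw [Matrix.toBilin'_apply]
    simp_rw [hM, Finset.mul_sum, Finset.sum_mul]
    refine (Finset.sum_congr rfl fun s _ => Finset.sum_comm).trans ?_
    exact Finset.sum_comm
  -- Step B: at fixed `π`, reindex the double sum by the columns `(d, b) = (s.2, t.2)`
  have hB : ∀ π : Equiv.Perm (Fin n),
      (∑ s : Fin n × Fin n, ∑ t : Fin n × Fin n,
        u s * (if π t.2 = t.1 ∧ s.2 ≠ t.2 ∧ π s.2 = s.1 then
          ∏ i ∈ (Finset.univ.erase t.2).erase s.2, P (π i, i) else 0) * v t) =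
      ∑ db : Fin n × Fin n, if db.1 ≠ db.2 then
        u (π db.1, db.1) *
          (∏ i ∈ (Finset.univ.erase db.2).erase db.1,
            (if i ≠ j₀ ∧ i ≠ b' ∧ π i = τ i then (1 : ℂ) else 0)) * v (π db.2, db.2) else 0 := by
    intro π
    rw [← Fintype.sum_prod_type']
    -- the summand vanishes off the image of `(d, b) ↦ ((π d, d), (π b, b))`
    let φ : Fin n × Fin n ↪ (Fin n × Fin n) × (Fin n × Fin n) :=
      ⟨fun db => ((π db.1, db.1), (π db.2, db.2)), fun x y hxy => by
        have h := Prod.ext_iff.mp hxy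
        exact Prod.ext (Prod.ext_iff.mp h.1).2 (Prod.ext_iff.mp h.2).2⟩
    rw [← Finset.sum_subset (Finset.subset_univ ((Finset.univ : Finset (Fin n × Fin n)).map φ)),
      Finset.sum_map]
    · refine Finset.sum_congr rfl fun db _ => ?_
      obtain ⟨d, b⟩ := db
      simp only [φ, Function.Embedding.coeFn_mk, hP, true_and, and_true]
      by_cases hdb : d ≠ b
      · rw [if_pos hdb, if_pos hdb]
      · rw [if_neg hdb, if_neg hdb, mul_zero, zero_mul]
    · rintro ⟨s, t⟩ - hst
      have hne : ¬ (π t.2 = t.1 ∧ s.2 ≠ t.2 ∧ π s.2 = s.1) := by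
        rintro ⟨h1, -, h3⟩
        apply hst
        rw [Finset.mem_map]
        refine ⟨(s.2, t.2), Finset.mem_univ _, ?_⟩
        simp only [φ, Function.Embedding.coeFn_mk]
        rw [h1, h3]
      dsimp only
      rw [if_neg hne, mul_zero, zero_mul]
  -- Step C: assemble
  rw [hA]
  simp_rw [hB, sum_testPoint_perm τ _ hjb u v]
  have hne : τ ≠ τ * Equiv.swap j₀ b' := by
    intro h
    have h1 : Equiv.swap j₀ b' = 1 := (mul_eq_left.mp h.symm)
    exact hjb (Equiv.swap_eq_refl_iff.mp h1)
  rw [← Finset.sum_subset (Finset.subset_univ ({τ, τ * Equiv.swap j₀ b'} : Finset _)),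
    Finset.sum_pair hne]
  · have hgτ : ∀ i, i ≠ j₀ → i ≠ b' → τ i = τ i := fun _ _ _ => rfl
    have hgσ : ∀ i, i ≠ j₀ → i ≠ b' → (τ * Equiv.swap j₀ b') i = τ i := fun i h1 h2 => by
      rw [Equiv.Perm.mul_apply, Equiv.swap_apply_of_ne_of_ne h1 h2]
    rw [if_pos hgτ, if_pos hgσ]
    simp only [Equiv.Perm.mul_apply, Equiv.swap_apply_left, Equiv.swap_apply_right]
  · intro π _ hπ
    rw [if_neg]
    intro hgood
    apply hπ
    rcases perm_eq_or_eq_mul_swap_of_agree π τ hjb hgood with rfl | rfl <;> simp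

/-- **Second-order flat subspaces of the permanent are small.** If a linear subspace `K` of
`n × n` matrices is totally isotropic for the Hessian of `per_n` at EVERY point (equivalently:
`per_n` is affine along every coset `x + K`), then `dim K ≤ 2n`.  (Sharp order: a row gives
`dim K = n`.)  Proof: pick `w ∈ K` with `w_{i₀ j₀} ≠ 0`; the polarised `2 × 2` permanents
(Hessians at zeroed permutation matrices) show that `v ↦ (row i₀ of v, column j₀ of v)` is
injective on `K`. [folklore] -/
theorem finrank_le_of_hess0_perPoly_isOrtho (K : Submodule ℂ (Fin n × Fin n → ℂ))
    (hK : ∀ p : Fin n × Fin n → ℂ, ∀ u ∈ K, ∀ v ∈ K,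
      Matrix.toBilin' (hess0 (transl p (perPoly (Fin n) ℂ))) u v = 0) :
    Module.finrank ℂ K ≤ 2 * n := by
  classical
  by_cases hbot : K = ⊥
  · rw [hbot, finrank_bot]; exact Nat.zero_le _
  obtain ⟨w, hwK, hw0⟩ := (Submodule.ne_bot_iff K).mp hbot
  obtain ⟨⟨i₀, j₀⟩, hw⟩ := Function.ne_iff.mp hw0
  -- every `v ∈ K` with zero row `i₀` and zero column `j₀` vanishes
  have hzero : ∀ v ∈ K, (∀ j, v (i₀, j) = 0) → (∀ i, v (i, j₀) = 0) → v = 0 := by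
    intro v hv hrow hcol
    funext ⟨a, b⟩
    by_cases ha : a = i₀
    · subst ha; exact hrow b
    by_cases hb : b = j₀
    · subst hb; exact hcol a
    -- a permutation with `τ j₀ = i₀`, `τ b = a`
    set τ : Equiv.Perm (Fin n) := Equiv.swap a (Equiv.swap i₀ j₀ b) * Equiv.swap i₀ j₀ with hτ
    have hτj : τ j₀ = i₀ := by
      rw [hτ, Equiv.Perm.mul_apply, Equiv.swap_apply_right]
      refine Equiv.swap_apply_of_ne_of_ne (Ne.symm ha) ?_
      intro h
      apply hb
      have h' := Equiv.swap_apply_eq_iff.mp h.symm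
      rwa [Equiv.swap_apply_left] at h'
    have hτb : τ b = a := by
      rw [hτ, Equiv.Perm.mul_apply, Equiv.swap_apply_right]
    have key := toBilin_hess0_perPoly_testPoint τ (Ne.symm hb) w v
    rw [hK _ w hwK v hv, hτj, hτb, hrow j₀, hrow b, hcol a, mul_zero, mul_zero, mul_zero,
      zero_add, add_zero, add_zero] at key
    exact (mul_eq_zero.mp key.symm).resolve_left hw
  -- the restriction map to (row `i₀`, column `j₀`) is injective on `K`
  let L : (Fin n × Fin n → ℂ) →ₗ[ℂ] (Fin n → ℂ) × (Fin n → ℂ) :=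
    LinearMap.prod (LinearMap.pi fun j => LinearMap.proj (i₀, j))
      (LinearMap.pi fun i => LinearMap.proj (i, j₀))
  have hinj : Function.Injective (L ∘ₗ K.subtype) := by
    intro x y hxy
    apply Subtype.ext
    have h := hzero (x.1 - y.1) (K.sub_mem x.2 y.2)
    have hLxy : L (x.1 - y.1) = 0 := by
      rw [map_sub, sub_eq_zero]
      exact hxy
    have hrow : ∀ j, (x.1 - y.1) (i₀, j) = 0 := fun j => by
      have := congrArg (fun q => q.1 j) hLxy
      simpa [L] using this
    have hcol : ∀ i, (x.1 - y.1) (i, j₀) = 0 := fun i => by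
      have := congrArg (fun q => q.2 i) hLxy
      simpa [L] using this
    exact sub_eq_zero.mp (h hrow hcol)
  calc Module.finrank ℂ K ≤ Module.finrank ℂ ((Fin n → ℂ) × (Fin n → ℂ)) :=
        LinearMap.finrank_le_finrank_of_injective hinj
    _ = 2 * n := by simp; ring

end PermanentFlat

end Summit.ValiantsHypothesis.ValiantsHypothesis.Cruxes.TwoDimCoefficients.DimTwoCases

end
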